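import Literature.MathematicalPhysics.QuantumFieldTheory.Balaban1983to89.B3Ineq210RegularTorus
import Literature.MathematicalPhysics.QuantumFieldTheory.Balaban1983to89.B3Ineq210ZeroTorus
import Literature.MathematicalPhysics.QuantumFieldTheory.Balaban1983to89.B1Eq220ZeroFieldTorusLevels

/-!
# `Balaban1983to89.B3Ineq210RegularZeroBridge` — T. Bałaban, *(Higgs)₂,₃ quantum fields in a finite volume. III. Renormalization*,
# Commun. Math. Phys. **88** (1983) 411–445 [Balaban1983Higgs3]: (2.10) p. 426 — AT ZERO BACKGROUND THE TWO TORUS CARRIERS OF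
# RECORD ARE ONE.  r14's covariant carrier `B3Ineq210RegularTorus.regTorusKernels S C A m² a k` (regular background `B̃ = A`,
# `u(N)`-valued coupling, `Ω = T_η`) at `A = 0` IS `N` colour copies of p03's scalar carrier `B3Ineq210ZeroTorus.zeroTorusKernels`
# of Bałaban's scalar torus tower, read through p14's carrier identification `B1Eq211ZeroFieldTorusLevels.eSiteAt` (the tori
# (I.1.2) of the sub-family `M·L′_μ = L^m` ARE `Setup`'s tori with top level `k`); `ScaledKernels.Ineq210` TRANSFERS between them
# in both directions, and p03's hypothesis-free torus theorem gives (2.10) for r14's carrier at `A = 0` without any tiling /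
# smallness / `m² > 0` hypothesis

statement-level skeleton of published theorems with citation tags; proofs where landed; nothing here is a claim about the Yang–Mills mass gap

KIND «dictionary» (HOME ruling G.5-54): a bridge between two formalizations of the SAME printed object — the scale pieces
`G^η_{(j)}(Ω, B̃)` of (2.6) p. 424 and their bound (2.10) p. 426 on the torus `Ω = T_η` at `B̃ = 0` — with no print provenance claimed
for the identification itself beyond [Balaban1982Higgs1] p. 608 *"The renormalization transformations for vector fields will be
obtained by taking N = d and an external vector field A = 0"* (the covariant operators at `A = 0` are `N` copies of the scalar
ones) and (2.22) p. 610 (the rescaling to the `L^{−k}`-lattice).  PDF held: `paper:balaban1983-higgs-2-3-quantum-fields-finite-volume`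
(journal page = PDF page + 410), p. 424 [PDF 14] (2.6), p. 426 [PDF 16] (2.10), render
`run/shared/lean/pub/pub-balaban/b2b-balaban-ref1/pages/1983-cmp88-higgs23-III/1983-cmp88-higgs23-III-p016-x2.png`;
`paper:balaban1982-cmp85-higgs23-i` (journal page = PDF page + 602), pp. 604–612 [PDF 2–10] ((1.2)–(1.7), (2.7), (2.11),
(2.20)–(2.22), (2.30), (2.43)).

CITATION HEADER (lean-in-tree rule).  Cell `lit-balaban` (HOME `run/shared/lean/pub/lit-balaban/`), Phase-2 proof seat **p33**
gen 56 (unit `lit-balaban-p33`), free target under G.5-34(d): r15's `B3-CLOSURE.md` v1.5 §5 item 5 residual *«an A = 0 bridging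
theorem `regTorusKernels` ↔ p03's `zeroTorusKernels` via `Shape.toSetup`/`eSite`»* (r14 g17 → r15 2026-08-22T19:35Z: *«At A = 0,
N = 1 they agree only THROUGH the dictionary … a bridging theorem nobody has written»*).  SKELETON rows **B3.Eq2.10** (decl of
record `B3Sect2StatementsPart2.ScaledKernels.Ineq210`, owner r15; located member) and **B3.Eq2.6**.  USED BY NAME, never
restated: r14's `B3Ineq210RegularTorus.{regTorusKernels, pieceA, termA, sandwich, sum_pieceA-vocabulary, mesh_eq_pow_mul, card_Ix,
regularTorus_hypotheses_nonvacuous}` (p339501); p03's `B3Ineq210ZeroTorus.{zeroTorusKernels, pieceT, pieceT_zero/of_pos/of_le,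
scaleT_eq, abs_pieceT_le_of, abs_derivPieceT_le_of}` (p258063); p14's `B1Eq211ZeroFieldTorusLevels.{setupAt, eSiteAt, cmpAt,
eSiteAt_shift, eSiteAt_blockOf, mesh_zero_eq_at, le_range_at, avgQkLin/avgQkAdj/covOpK_charge_zeroField}` and
`B1Eq220ZeroFieldTorusLevels.{avgQkLin_zero_apply_at, avgQkAdj_zero_apply_at, projPk_zero_apply_at, covLaplacianN_zero_apply_at,
hOp_setupAt_mulVec_apply, T_eSiteAt}`, `B1Ineq225ZeroFieldTorus.{G_mul_opS, G0unit_decay_cap}`; p35's `B1Eq230FluctCov.{cb, Ix,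
deltaKA, precOpA, fluctCovA, blockProjA}`, `B1Eq27StepAdjoint.{avgQLin, avgQAdjLin}`, `B1Eq243HiggsModel.{covOpK_mul_propagatorK_univ,
isUnit_precOpA_of_next, isUnit_covOpK_univ_of_pos}`; pv07/p38's `B1RG242Torus.{tower, Qk, Qks, Q, Qs, H, α, β, C_arg, Q_mulVec,
Qs_mulVec, deriv}`, `B1RG242.StepData.mul_Ck`, `B4Thm110ZeroTorus.kerBounds_torus`, `B5Leaf237C0Torus.{gamma0, dK0}`,
`B4Ineq116Torus.spacing_le_spacing`; the typer's `HiggsLattice`/`HiggsCovariance` carriers; r15's `B3Sect2StatementsPart2.ScaledKernels`.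

WHAT IS PRINTED (verbatim).  [Balaban1983Higgs3] p. 424 [PDF 14]: *"G_k(Ω,B̃) = Σ_{j=0}^{k−1} G^η_{(j)}(Ω,B̃) (2.6)"*; p. 426
[PDF 16]: *"For the propagators G^η_{(j)} we apply the inequality |G^η_{(j)}(Ω, B̃; x, x′)| ≤ O(1)(L^jη)^{−d+2}e^{−δ₁(L^jη)^{−1}|x−x′|},
(2.10) and if the propagator is differentiated, then for each differentiation, there is an additional factor (L^jη)^{−1} on the
right side. … They all are obtained by rescaling from the η-lattice to the L^{−j}-lattice and application of Propositions I.2.1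
and I.2.3."*  [Balaban1982Higgs1] p. 608 [PDF 6]: *"The renormalization transformations for vector fields will be obtained by taking
N = d and an external vector field A = 0, so we will not consider them separately"*; p. 610 [PDF 8], (2.22): *"Let us rescale the
operators (2.20), (2.21) from ε-lattice to L^{−k}-lattice … G_k(Ω,A) = (−Δ^{η,N}_{A,Ω} + m²(L^kε)² + a_kP_k(A))^{−1}, η = L^{−k}. This
operator can be treated as defined on the unit lattice because L^kη = 1"*.

WHAT THIS FILE PROVES (kernel-checked, zero `sorry`; axioms standard; the new `def`s `cmpL`, `deltaS`, `covS` are transports /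
concretely-typed copies of tower data, no `def … : Prop`, no new named fact).  Throughout `S : Shape P` (the torus sub-family),
`k ≤ K`, the level-`k` `Setup` torus `setupAt S k` (top level `k`, `η = L^{−k}`), `ℓ := L^kε = P.mesh k`, `e := eSiteAt S _ _`
(the identification `T^{(j)}_{L^jε} ≃ T^{(j)}`), and the scalar tower `tower (setupAt S k) a (m²ℓ²)` of `B1RG242Torus` (mass `m²ℓ²`
= (2.22)).
* §0 scalars: `L^jε = ℓ·(L^jη)` (`mesh_eq_mul_spacing`), `a_j(L^jε)^{−2} = ℓ^{−2}α_j` (`coeff221_eq_alpha`), `a(L^{j+1}ε)^{−2} = ℓ^{−2}β_j`.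
* §1 `cmpL` (the `i`-th colour of a level-`j` field read on `T^{(j)}`; `= cmpAt` at `j = 0`) and, AT ZERO FIELD FOR EVERY COUPLING
  `U = exp(qεeA)` (`U(0) = 1`), the averaging dictionaries at every level `j ≤ k`: (2.11) `Q_j` (`cmpL_avgQkLin`), `Q_j^*`
  (`cmpAt_avgQkAdj`), the one-step (2.7) `Q` and `Q^*` (`cmpL_avgQLin`, `cmpL_avgQAdjLin` — new: p14 has only the `k`-fold ones).
* §2 AT EVERY LEVEL `j ≤ k` (p14's dictionaries are `j = k` only): the operator of (2.20) (`cmpAt_covOpK_level`: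
  `cmp_i((−Δ^ε + m² + a_j(L^jε)^{−2}P_j)φ) = ℓ^{−2}(H_S(m²ℓ²) + α_jQ^*_jQ_j)cmp_iφ`), **`G^ε_j(T_ε,0) = ℓ²·G_j ⊗ 1`**
  (`cmpAt_propagatorK_level`, genuine inverses on both sides), (2.21) `Δ^{(j)} = ℓ^{−2}Δ_j ⊗ 1` (`cmpL_deltaKA`), the one-step
  `P = Q^*Q` (`cmpL_blockProjA`), the operator of (2.30) (`cmpL_precOpA`), **`C^{(j)}(T_ε,0) = ℓ²·C^{(j)} ⊗ 1`** (`cmpL_fluctCovA`,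
  "It is so" on both sides), and **the `j`-th term of (I.2.43) `= ℓ²·term_j ⊗ 1`** (`cmpAt_termA`); the tower's `Δ_j`, `C^{(j)}`
  are written as matrices over `Site (setupAt S k) j` (`deltaS`, `covS`, definitionally the tower's: `step_Δk_eq`, `towerC_eq`,
  `towerTerm_eq`, `covS_mul`).
* §3 THE PIECES (2.6): `cmp_i(G^η_{(j)}(T_ε,0)φ) = ℓ²·(G^η_{(j)} cmp_iφ)` for r14's `pieceA` vs p03's `pieceT`, all `j`
  (`cmpAt_pieceA`); vector form (`pieceA_zeroField_apply`); on the coordinate basis `e_{(x′,i′)}` (`pieceA_zeroField_cb`,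
  `norm_cb_self`): `‖(G^η_{(j)}e_{(x′,i′)})(x)‖ = ℓ²|G^η_{(j)}(e x, e x′)|` (`norm_pieceA_cb`), the column sum over the `N` source
  colours (`sum_norm_pieceA_cb`), and the covariant derivative (I.1.7) at `A = 0` of a piece (`covDeriv_pieceA_cb`,
  `sum_norm_covDeriv_pieceA_cb`).
* §4 THE CARRIER DICTIONARY: `scale_H j = ℓ·scale_S j` (`scale_bridge`), `dist_H x x′ = ℓ·dist_S (e x) (e x′)` (`dist_bridge`,
  (I.1.3) = the sup torus distance), **`absG_H j x x′ = N·ℓ²(ℓ^d)^{−1}·absG_S j (e x) (e x′)`** (`absG_bridge`),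
  **`absDG_H j μ x x′ = N·ℓ(ℓ^d)^{−1}·absDG_S j μ (e x) (e x′)`** (`absDG_bridge`); hence **TRANSFER**: `Ineq210 δ₁ C` for
  `zeroTorusKernels (setupAt S k) a (m²ℓ²) k` ⟹ `Ineq210 δ₁ (N·C)` for `regTorusKernels S C 0 m² a k` (`ineq210_reg_of_zero`), and
  conversely with `C/N` for `N ≥ 1` (`ineq210_zero_of_reg`) — the powers of `ℓ` cancel exactly.
* §5 **(2.10) FOR r14's CARRIER AT `A = 0`, HYPOTHESIS-FREE** (`ineq210_regularTorus_zeroField`): `d ≥ 1`, odd `L > 1`, `a > 0`,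
  `m² ≥ 0`, every `N`, every coupling: `∃ δ₁ C > 0 ∀ P (S : Shape P)` with these `d, L`, `∀ 1 ≤ k ≤ K` with `L^kε ≤ 1`,
  `(regTorusKernels S C 0 m² a k).Ineq210 δ₁ C` — via p03's torus theorem re-assembled over the mass window `0 ≤ m² ≤ m₊²`
  (`ineq210_zeroTorus_massWindow`: p03's `ineq210_zeroTorus` verbatim with p14's `G0unit_decay_cap` and `kerBounds_torus`'s window)
  and the transfer; non-vacuity `zeroField_hypotheses_nonvacuous`.

HONEST SCOPE / DECLARED DIVERGENCES.  (i) Zero background only (`A = 0`; then every coupling `C` gives the same operators,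
p14's §3): nothing here touches r14's regular `A ≠ 0` or p03's boxes/regions; `Ω = T_η` only.  (ii) The `Setup` torus of the
bridge is p14's LEVEL-`k` torus `setupAt S k = (d, L, m + (K − k), k)` (unit lattice = `T^{(k)}`, the rescaling (2.22) at the
scale `k` of the carrier), not `Shape.toSetup = setupAt S K`: with it the mass of the scalar tower is `m²(L^kε)²` and the
hypothesis of §5 is `L^kε ≤ 1` — the one r14's theorem carries; r15's wording «via `Shape.toSetup`/`eSite`» is the case `k = K`.
(iii) The colour factor: r14's `absG` is the column-SUM norm over the `N` source colours of the `N × N` block, which at `A = 0`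
is `N` times the scalar kernel (not `1` times) — so the constants transfer as `C ↦ N·C`; for `N = 0` the covariant carrier is
identically `0`.  (iv) (2.5), (2.11), (2.12) are not modelled by either carrier (fields `0`), untouched here.  (v) §5's constants
depend on `(d, L, a, m², N)` and are uniform in the volume, `k` and `j`; the window re-assembly repeats p03's 40-line proof
because p03's theorem fixes the mass (no statement of p03/r14/p14 is altered).  Value = kernel certificate that the two Phase-2
members of row B3.Eq2.10 are ONE statement at zero background (consistency of the cell's two carriers), NOT summit progress.
Unit `lit-balaban-p33` gen 56 (literature-prover-lit-balaban-p33-g56-0); HOME rows B3.Eq2.10 / B3.Eq2.6 (owner r15).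
-/

noncomputable section

open scoped BigOperators Matrix

namespace Literature.MathematicalPhysics.QuantumFieldTheory.Balaban1983to89.B3Ineq210RegularZeroBridge

open HiggsLattice (ChargeData ScalarField covDeriv)
open HiggsCovariance (propagatorK avgQkLin avgQkAdj covOpK projPk covLaplacianN)
open HiggsAveraging (blockIter blockK avgQ_apply contourSum segSum toFinest)
open HiggsFluctMeasure (coeff221 coeff221_eq)
open B1Eq27StepAdjoint (avgQLin avgQAdjLin avgQLin_apply avgQAdjLin_apply)
open B1Eq230FluctCov (Ix cb fluctCovA precOpA deltaKA blockProjA deltaKA_succ)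
open B1Eq211ZeroFieldTorus (Shape)
open B1Eq211ZeroFieldTorusLevels (setupAt setupAt_L setupAt_d setupAt_K mesh_zero_eq_at le_range_at eSiteAt eSiteAt_shift
  eSiteAt_blockOf cmpAt cmpAt_apply cmpAt_apply_eSiteAt eq_of_cmpAt_eq avgQkLin_charge_zeroField avgQkAdj_charge_zeroField
  covOpK_charge_zeroField)
open B1Eq220ZeroFieldTorusLevels (avgQkLin_zero_apply_at avgQkAdj_zero_apply_at projPk_zero_apply_at covLaplacianN_zero_apply_at
  hOp_setupAt_mulVec_apply T_eSiteAt)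
open B1RG242Torus (tower Qk Qks Qs H hOp α β G_arg C_arg one_lt_cast_L Q_mulVec Qs_mulVec)
open B1Ineq225ZeroFieldTorus (opS_mul_G G_mul_opS)
open B3MultiscaleFields (zeroCharge zeroCharge_U)
open B3Sect2StatementsPart2 (ScaledKernels)
open B3Ineq210RegularTorus (pieceA termA sandwich regTorusKernels mesh_eq_pow_mul)
open B3Ineq210ZeroTorus (pieceT zeroTorusKernels)

variable {P : HiggsLattice.Params} {N : ℕ}

/-! ## §0 Scalars: the model's meshes against the level-`k` `Setup` torus (`ℓ = L^kε`) -/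

section Scalars

variable (S : Shape P) (k : ℕ)

/-- `L^jε = ℓ · (L^j η)`, `ℓ = L^kε`, `η = L^{−k}` — the model's mesh at level `j` is `ℓ` times the spacing of the level-`k`
`Setup` torus at level `j` ((2.22): lengths rescaled by `L^kε`). [cite: Balaban1982Higgs1, (2.22) p.610] -/
theorem mesh_eq_mul_spacing (j : ℕ) : P.mesh j = P.mesh k * (setupAt S k).spacing j := by
  rw [mesh_eq_pow_mul P j, mesh_zero_eq_at S k]
  unfold Params.spacing
  rw [setupAt_L]
  ring

/-- `a_j(L^jε)^{−2} = ℓ^{−2}·α_j` with `α_j = a_j(L^jη)^{−2}` the coefficient of the level-`k` torus tower ((2.20)/(2.22)).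
[cite: Balaban1982Higgs1, (2.22) p.610] -/
theorem coeff221_eq_alpha (a : ℝ) (j : ℕ) : coeff221 P a j = (P.mesh k ^ 2)⁻¹ * α (setupAt S k) a j := by
  rw [coeff221_eq]
  show B1.aSeq a P.L j * ((P.mesh j)⁻¹ ^ 2) = (P.mesh k ^ 2)⁻¹ * (B1.aSeq a (setupAt S k).L j * ((setupAt S k).spacing j ^ 2)⁻¹)
  rw [setupAt_L, mesh_eq_mul_spacing S k j, inv_pow, mul_pow, mul_inv]
  ring

/-- `a(L^{j+1}ε)^{−2} = ℓ^{−2}·β_j` with `β_j = a(L^{j+1}η)^{−2}` ((2.30)/(2.22)). [cite: Balaban1982Higgs1, (2.22) p.610] -/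
theorem beta_coeff_eq (a : ℝ) (j : ℕ) :
    a * ((P.mesh (j + 1))⁻¹ ^ 2) = (P.mesh k ^ 2)⁻¹ * β (setupAt S k) a j := by
  show a * ((P.mesh (j + 1))⁻¹ ^ 2) = (P.mesh k ^ 2)⁻¹ * (a * ((setupAt S k).spacing (j + 1) ^ 2)⁻¹)
  rw [mesh_eq_mul_spacing S k (j + 1), inv_pow, mul_pow, mul_inv]
  ring

/-- `ε = ℓ·η`. [cite: Balaban1982Higgs1, (2.22) p.610] -/
theorem mesh_zero_eq (k : ℕ) : P.mesh 0 = P.mesh k * (setupAt S k).eps := mesh_zero_eq_at S k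

end Scalars

/-! ## §1 Components at level `j` and the zero-field dictionaries for `Q`, `Q^*`, `Q_j`, `Q_j^*` -/

section Components

variable (S : Shape P) {k : ℕ} (hk : k ≤ P.K)

/-- The `i`-th component of an `ℝ^N`-valued field on `T^{(j)}_{L^jε}`, read on level `j` of the level-`k` `Setup` torus
(`j ≤ k`): `g ↦ (w ↦ g(e_j⁻¹ w)_i)`; at `j = 0` this is p14's `cmpAt`. [cite: Balaban1982Higgs1, (1.5) p.604] -/
def cmpL {j : ℕ} (hj : j ≤ k) (i : Fin N) : ScalarField P j N →ₗ[ℝ] (Site (setupAt S k) j → ℝ) where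
  toFun g := fun w => g ((eSiteAt S hk hj).symm w) i
  map_add' g h := by funext w; simp only [Pi.add_apply, PiLp.add_apply]
  map_smul' c g := by funext w; simp only [Pi.smul_apply, PiLp.smul_apply, smul_eq_mul, RingHom.id_apply]

/-- Unfolding of `cmpL`. [cite: Balaban1982Higgs1, (1.5) p.604] -/
@[simp] theorem cmpL_apply {j : ℕ} (hj : j ≤ k) (i : Fin N) (g : ScalarField P j N) (w : Site (setupAt S k) j) :
    cmpL S hk hj i g w = g ((eSiteAt S hk hj).symm w) i := rfl

/-- `cmpL` at an identified site. [cite: Balaban1982Higgs1, (1.5) p.604] -/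
theorem cmpL_apply_eSiteAt {j : ℕ} (hj : j ≤ k) (i : Fin N) (g : ScalarField P j N) (y : HiggsLattice.Site P j) :
    cmpL S hk hj i g (eSiteAt S hk hj y) = g y i := by
  rw [cmpL_apply, Equiv.symm_apply_apply]

/-- At level `0`, `cmpL` is p14's `cmpAt`. [cite: Balaban1982Higgs1, (1.5) p.604] -/
theorem cmpL_zero (i : Fin N) : cmpL S hk (Nat.zero_le k) i = cmpAt S hk (N := N) i := rfl

variable {C : ChargeData N}

/-- At zero field the staircase sum vanishes. [cite: Balaban1982Higgs1, (2.1) p.608] -/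
private theorem contourSum_zero_field (y x : HiggsLattice.Site P 0) :
    contourSum (0 : HiggsLattice.VecField P 0) y x = 0 := by
  simp [contourSum, segSum]

/-- **(2.11) at zero field IS `Setup`'s `Q_j`, every coupling** (`j ≤ k`): `cmp_{j,i}(Q_j(0)f) = Q_j cmp_{0,i}f`.
[cite: Balaban1982Higgs1, (2.11) p.609] -/
theorem cmpL_avgQkLin {j : ℕ} (hj : j ≤ k) (C : ChargeData N) (i : Fin N) (f : ScalarField P 0 N) :
    cmpL S hk hj i (avgQkLin C (0 : HiggsLattice.VecField P 0) j f) = Qk (setupAt S k) j *ᵥ cmpAt S hk i f := by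
  funext w
  rw [← Equiv.apply_symm_apply (eSiteAt S hk hj) w, cmpL_apply_eSiteAt, avgQkLin_charge_zeroField,
    avgQkLin_zero_apply_at S hk 1 0 hj, Equiv.apply_symm_apply]
  rfl

/-- **`Q_j^*` at zero field IS `Setup`'s `Q^*_j`, every coupling** (`j ≤ k`). [cite: Balaban1982Higgs1, (2.20) p.610] -/
theorem cmpAt_avgQkAdj {j : ℕ} (hj : j ≤ k) (C : ChargeData N) (i : Fin N) (g : ScalarField P j N) :
    cmpAt S hk i (avgQkAdj C (0 : HiggsLattice.VecField P 0) j g) = Qks (setupAt S k) j *ᵥ cmpL S hk hj i g := by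
  funext z
  rw [← Equiv.apply_symm_apply (eSiteAt S hk (Nat.zero_le _)) z, cmpAt_apply_eSiteAt, avgQkAdj_charge_zeroField,
    avgQkAdj_zero_apply_at S hk 1 0 hj, Equiv.apply_symm_apply]
  rfl

/-- **The one-step average (2.7) at zero field IS `Setup`'s `Q` on `T^{(j)}`, every coupling** (`j + 1 ≤ k`).
[cite: Balaban1982Higgs1, (2.7) p.608] -/
theorem cmpL_avgQLin {j : ℕ} (hj1 : j + 1 ≤ k) (C : ChargeData N) (i : Fin N) (g : ScalarField P j N) :
    cmpL S hk hj1 i (avgQLin C (0 : HiggsLattice.VecField P 0) j g)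
      = B1RG242Torus.Q (setupAt S k) j *ᵥ cmpL S hk (Nat.le_of_succ_le hj1) i g := by
  funext w
  rw [← Equiv.apply_symm_apply (eSiteAt S hk hj1) w, cmpL_apply_eSiteAt]
  set y := (eSiteAt S hk hj1).symm w
  have hQ : (B1RG242Torus.Q (setupAt S k) j *ᵥ cmpL S hk (Nat.le_of_succ_le hj1) i g) (eSiteAt S hk hj1 y)
      = (((P.L : ℝ)) ^ P.d)⁻¹ * ∑ z ∈ block (eSiteAt S hk hj1 y), cmpL S hk (Nat.le_of_succ_le hj1) i g z :=
    Q_mulVec 1 0 (le_range_at S k hj1) _ _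
  rw [avgQLin_apply, avgQ_apply, hQ]
  simp only [contourSum_zero_field, ChargeData.U_zero, one_apply_eq_self, PiLp.smul_apply, smul_eq_mul,
    WithLp.ofLp_sum, Finset.sum_apply]
  congr 1
  refine Finset.sum_equiv (eSiteAt S hk (Nat.le_of_succ_le hj1)) (fun x => ?_) (fun x _ => ?_)
  · simp only [HiggsLattice.block, block, Finset.mem_filter, Finset.mem_univ, true_and]
    rw [← eSiteAt_blockOf S hk hj1, (eSiteAt S hk hj1).apply_eq_iff_eq]
  · rw [cmpL_apply, Equiv.symm_apply_apply]

/-- **The one-step adjoint `Q^*` at zero field IS `Setup`'s `Q^*` on `T^{(j)}`, every coupling** (`j + 1 ≤ k`).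
[cite: Balaban1982Higgs1, (2.7) p.608] -/
theorem cmpL_avgQAdjLin {j : ℕ} (hj1 : j + 1 ≤ k) (C : ChargeData N) (i : Fin N) (h : ScalarField P (j + 1) N) :
    cmpL S hk (Nat.le_of_succ_le hj1) i (avgQAdjLin C (0 : HiggsLattice.VecField P 0) j h)
      = Qs (setupAt S k) j *ᵥ cmpL S hk hj1 i h := by
  funext w
  rw [← Equiv.apply_symm_apply (eSiteAt S hk (Nat.le_of_succ_le hj1)) w, cmpL_apply_eSiteAt]
  set x := (eSiteAt S hk (Nat.le_of_succ_le hj1)).symm w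
  have hQs : (Qs (setupAt S k) j *ᵥ cmpL S hk hj1 i h) (eSiteAt S hk (Nat.le_of_succ_le hj1) x)
      = cmpL S hk hj1 i h (blockOf (eSiteAt S hk (Nat.le_of_succ_le hj1) x)) := Qs_mulVec 1 0 (le_range_at S k hj1) _ _
  rw [avgQAdjLin_apply, hQs, contourSum_zero_field, ChargeData.U_zero, star_one,
    one_apply_eq_self, cmpL_apply, ← eSiteAt_blockOf S hk hj1, Equiv.symm_apply_apply]

end Components

/-! ## §2 The operator of (2.20), its inverse `G^ε_j(T_ε, 0)`, `Δ^{(j)}`, `C^{(j)}` and the terms of (I.2.43) at every level `j ≤ k`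

The `Setup`-side objects at the levels `j ≥ 1` are written as matrices over `Site (setupAt S k) j` with the torus's own
instances (the tower `B1RG242Torus.tower` carries the same instances as structure fields, so the identifications with the
tower's `Δ_j`, `C^{(j)}` are definitional — cf. `B5Display136Torus.C_def_site`). -/

section SetupSide

variable (S : Shape P) (k : ℕ) (a msq : ℝ)

/-- **`Δ_j` of the level-`k` torus tower at mass `m²ℓ²`** (`ℓ = L^kε`): `α_j·1 − α_j²·Q_jG_jQ^*_j` on `T^{(j)}` of `setupAt S k` —
(I.2.21) for Bałaban's scalar tower ((2.22)-rescaled), as a matrix over `Site (setupAt S k) j`.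
[cite: Balaban1982Higgs1, (2.21) p.610; (2.22) p.610] -/
def deltaS (j : ℕ) : Matrix (Site (setupAt S k) j) (Site (setupAt S k) j) ℝ :=
  α (setupAt S k) a j • (1 : Matrix (Site (setupAt S k) j) (Site (setupAt S k) j) ℝ)
    - α (setupAt S k) a j ^ 2 • (Qk (setupAt S k) j * (tower (setupAt S k) a (msq * P.mesh k ^ 2)).G j * Qks (setupAt S k) j)

/-- **`C^{(j)}` of the level-`k` torus tower at mass `m²ℓ²`**: `(β_jQ^*Q + Δ_j)^{−1}` on `T^{(j)}` of `setupAt S k` — (I.2.30) for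
Bałaban's scalar tower ((2.22)-rescaled), as a matrix over `Site (setupAt S k) j`. [cite: Balaban1982Higgs1, (2.30) p.611] -/
def covS (j : ℕ) : Matrix (Site (setupAt S k) j) (Site (setupAt S k) j) ℝ :=
  (β (setupAt S k) a j • (Qs (setupAt S k) j * B1RG242Torus.Q (setupAt S k) j) + deltaS S k a msq j)⁻¹

/-- `deltaS` IS the tower's `Δ_j` (definitional). [cite: Balaban1982Higgs1, (2.21) p.610] -/
theorem step_Δk_eq (j : ℕ) : ((tower (setupAt S k) a (msq * P.mesh k ^ 2)).step j).Δk = deltaS S k a msq j := by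
  unfold deltaS B1RG242.StepData.Δk
  rfl

/-- the tower's `β_jP + Δ_j` is the argument of `covS` (definitional). [cite: Balaban1982Higgs1, (2.30) p.611] -/
theorem step_C_arg_eq (j : ℕ) :
    ((tower (setupAt S k) a (msq * P.mesh k ^ 2)).step j).β • ((tower (setupAt S k) a (msq * P.mesh k ^ 2)).step j).P
        + ((tower (setupAt S k) a (msq * P.mesh k ^ 2)).step j).Δk
      = β (setupAt S k) a j • (Qs (setupAt S k) j * B1RG242Torus.Q (setupAt S k) j) + deltaS S k a msq j := by
  rw [step_Δk_eq]
  rfl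

/-- `covS` IS the tower's `C^{(j)}` (definitional). [cite: Balaban1982Higgs1, (2.30) p.611] -/
theorem towerC_eq (j : ℕ) : (tower (setupAt S k) a (msq * P.mesh k ^ 2)).C j = covS S k a msq j := by
  unfold covS
  rw [← step_C_arg_eq]
  rfl

/-- `C^{(j)}·(β_jQ^*Q + Δ_j) = 1` on the torus: the tower's `C^{(j)}` is a genuine inverse for `a > 0`, `m² ≥ 0`, `j ≥ 1`
(`B1RG242Torus.C_arg`, "It is so" p. 611). [cite: Balaban1982Higgs1, (2.30) p.611] -/
theorem covS_mul (ha : 0 < a) (hmsq : 0 ≤ msq) {j : ℕ} (hj1 : 1 ≤ j) :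
    covS S k a msq j * (β (setupAt S k) a j • (Qs (setupAt S k) j * B1RG242Torus.Q (setupAt S k) j) + deltaS S k a msq j) = 1 := by
  rw [← towerC_eq, ← step_C_arg_eq]
  exact B1RG242.StepData.mul_Ck ((tower (setupAt S k) a (msq * P.mesh k ^ 2)).step j)
    (C_arg (setupAt S k) ha (mul_nonneg hmsq (sq_nonneg _)) j hj1)

/-- The tower's term of (I.2.43) with `covS` (definitional): `term_j = α_j²·G_jQ^*_jC^{(j)}Q_jG_j`.
[cite: Balaban1982Higgs1, (2.43) p.612] -/
theorem towerTerm_eq (j : ℕ) :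
    (tower (setupAt S k) a (msq * P.mesh k ^ 2)).term j
      = α (setupAt S k) a j ^ 2 • ((tower (setupAt S k) a (msq * P.mesh k ^ 2)).G j * Qks (setupAt S k) j
          * covS S k a msq j * Qk (setupAt S k) j * (tower (setupAt S k) a (msq * P.mesh k ^ 2)).G j) := by
  rw [← towerC_eq]
  rfl

end SetupSide

section Operators

variable (S : Shape P) {k : ℕ} (hk : k ≤ P.K) (C : ChargeData N) {msq a : ℝ}

/-- **THE OPERATOR OF (2.20) AT ZERO FIELD, LEVEL `j ≤ k ≤ K`, READ ON THE LEVEL-`k` TORUS** (every coupling): the `i`-th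
component of `(−Δ^ε + m² + a_j(L^jε)^{−2}P_j)φ` is `ℓ^{−2}·((H_S(m²ℓ²) + α_jQ^*_jQ_j) cmp_iφ)`, `ℓ = L^kε`, `α_j = a_j(L^jη)^{−2}`,
`η = L^{−k}` — the rescaling (2.22) by `L^kε` at EVERY level `j` of the level-`k` tower (p14's `covOpK_zero_apply_at` is `j = k`).
[cite: Balaban1982Higgs1, (2.20) p.610; (2.22) p.610] -/
theorem cmpAt_covOpK_level (msq a : ℝ) {j : ℕ} (hj : j ≤ k) (φ : ScalarField P 0 N) (i : Fin N) :
    cmpAt S hk i (covOpK C Finset.univ (0 : HiggsLattice.VecField P 0) msq a j φ)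
      = (P.mesh k ^ 2)⁻¹ •
          ((H (setupAt S k) (msq * P.mesh k ^ 2) + α (setupAt S k) a j • (Qks (setupAt S k) j * Qk (setupAt S k) j))
            *ᵥ cmpAt S hk i φ) := by
  have hℓ : P.mesh k ≠ 0 := (P.mesh_pos k).ne'
  have hη : (setupAt S k).eps ≠ 0 := (setupAt S k).eps_pos.ne'
  have hsp : (setupAt S k).spacing j ≠ 0 := ((setupAt S k).spacing_pos j).ne'
  funext z
  rw [covOpK_charge_zeroField, ← Equiv.apply_symm_apply (eSiteAt S hk (Nat.zero_le _)) z, cmpAt_apply_eSiteAt]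
  set x := (eSiteAt S hk (Nat.zero_le _)).symm z
  -- the left side, term by term
  have hL : (covOpK (zeroCharge N) Finset.univ (0 : HiggsLattice.VecField P 0) msq a j φ x) i
      = (covLaplacianN (zeroCharge N) Finset.univ (0 : HiggsLattice.VecField P 0) φ x) i + msq * φ x i
        + B1.aSeq a P.L j * ((P.mesh j)⁻¹ ^ 2)
            * (projPk (zeroCharge N) (0 : HiggsLattice.VecField P 0) j φ x) i := by
    simp only [covOpK, LinearMap.add_apply, LinearMap.smul_apply, LinearMap.id_apply, Pi.add_apply, Pi.smul_apply,
      PiLp.add_apply, PiLp.smul_apply, smul_eq_mul]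
  -- the right side, term by term
  have hR : ((H (setupAt S k) (msq * P.mesh k ^ 2)
        + α (setupAt S k) a j • (Qks (setupAt S k) j * Qk (setupAt S k) j)) *ᵥ cmpAt S hk i φ)
          (eSiteAt S hk (Nat.zero_le _) x)
      = (hOp (setupAt S k) 0 (setupAt S k).eps (msq * P.mesh k ^ 2) *ᵥ cmpAt S hk i φ) (eSiteAt S hk (Nat.zero_le _) x)
        + α (setupAt S k) a j
            * (((tower (setupAt S k) a msq).Qks j * (tower (setupAt S k) a msq).Qk j) *ᵥ cmpAt S hk i φ)
                (eSiteAt S hk (Nat.zero_le _) x) := by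
    rw [Matrix.add_mulVec, Matrix.smul_mulVec, Pi.add_apply, Pi.smul_apply, smul_eq_mul]
    rfl
  have hα : α (setupAt S k) a j = B1.aSeq a P.L j * ((setupAt S k).spacing j ^ 2)⁻¹ := rfl
  have hmj : P.mesh j = P.mesh k * (setupAt S k).spacing j := mesh_eq_mul_spacing S k j
  have hε : P.mesh 0 = P.mesh k * (setupAt S k).eps := mesh_zero_eq_at S k
  rw [Pi.smul_apply, smul_eq_mul, hL, hR, covLaplacianN_zero_apply_at S hk, hOp_setupAt_mulVec_apply,
    ← projPk_zero_apply_at S hk a msq hj, hα, hmj, hε, cmpAt_apply_eSiteAt]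
  field_simp
  ring

/-- **(2.20) AT ZERO FIELD, LEVEL `1 ≤ j ≤ k ≤ K`, IS `ℓ²·G_j` OF THE LEVEL-`k` TORUS TOWER** (every coupling, `a > 0`, `m² ≥ 0`):
`cmp_i(G^ε_j(T_ε,0)φ) = ℓ²·(G_j cmp_iφ)`, `G_j = (H_S(m²ℓ²) + α_jQ^*_jQ_j)^{−1}` — p14's `cmpAt_propagatorK` is the case `j = k`.
[cite: Balaban1982Higgs1, (2.20) p.610; (2.22) p.610] -/
theorem cmpAt_propagatorK_level (ha : 0 < a) (hmsq : 0 ≤ msq) {j : ℕ} (hj1 : 1 ≤ j) (hj : j ≤ k)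
    (φ : ScalarField P 0 N) (i : Fin N) :
    cmpAt S hk i (propagatorK C Finset.univ (0 : HiggsLattice.VecField P 0) msq a j φ)
      = (P.mesh k ^ 2) • ((tower (setupAt S k) a (msq * P.mesh k ^ 2)).G j *ᵥ cmpAt S hk i φ) := by
  have hℓ2 : P.mesh k ^ 2 ≠ 0 := pow_ne_zero 2 (P.mesh_pos k).ne'
  have hm' : 0 ≤ msq * P.mesh k ^ 2 := mul_nonneg hmsq (sq_nonneg _)
  have hL1 : (1 : ℝ) < P.L := by exact_mod_cast S.hL.2
  have h1 : covOpK C Finset.univ (0 : HiggsLattice.VecField P 0) msq a j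
      (propagatorK C Finset.univ (0 : HiggsLattice.VecField P 0) msq a j φ) = φ := by
    have := B1Eq243HiggsModel.covOpK_mul_propagatorK_univ C (0 : HiggsLattice.VecField P 0) hmsq (B1.aSeq_pos ha hL1 hj1)
      (k := j)
    exact congrArg (fun f : Module.End ℝ (ScalarField P 0 N) => f φ) this
  have h2 := congrArg (fun v => (tower (setupAt S k) a (msq * P.mesh k ^ 2)).G j *ᵥ v)
    (cmpAt_covOpK_level S hk C msq a hj (propagatorK C Finset.univ (0 : HiggsLattice.VecField P 0) msq a j φ) i)
  beta_reduce at h2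
  rw [h1, Matrix.mulVec_smul, Matrix.mulVec_mulVec, G_mul_opS (setupAt S k) ha hm' hj1, Matrix.one_mulVec] at h2
  rw [h2, smul_smul, mul_inv_cancel₀ hℓ2, one_smul]

/-- **`Δ^{(j)}` (2.21) AT ZERO FIELD IS `ℓ^{−2}·Δ_j` OF THE LEVEL-`k` TORUS TOWER** (`1 ≤ j ≤ k`, every coupling):
`cmp_{j,i}(Δ^{(j),L^jε}(T_ε,0)g) = ℓ^{−2}·(Δ_j cmp_{j,i}g)`, `Δ_j = α_j − α_j²Q_jG_jQ^*_j`. [cite: Balaban1982Higgs1, (2.21) p.610] -/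
theorem cmpL_deltaKA (ha : 0 < a) (hmsq : 0 ≤ msq) {j : ℕ} (hj1 : 1 ≤ j) (hj : j ≤ k) (g : ScalarField P j N) (i : Fin N) :
    cmpL S hk hj i (deltaKA C Finset.univ (0 : HiggsLattice.VecField P 0) msq a j g)
      = (P.mesh k ^ 2)⁻¹ • (deltaS S k a msq j *ᵥ cmpL S hk hj i g) := by
  obtain ⟨j', rfl⟩ : ∃ j', j = j' + 1 := ⟨j - 1, by omega⟩
  have hℓ2 : P.mesh k ^ 2 ≠ 0 := pow_ne_zero 2 (P.mesh_pos k).ne'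
  rw [deltaKA_succ, LinearMap.sub_apply, LinearMap.smul_apply, LinearMap.smul_apply, LinearMap.id_apply, map_sub, map_smul,
    map_smul, LinearMap.comp_apply, LinearMap.comp_apply, cmpL_avgQkLin S hk hj, cmpAt_propagatorK_level S hk C ha hmsq hj1 hj,
    Matrix.mulVec_smul, cmpAt_avgQkAdj S hk hj, Matrix.mulVec_mulVec, Matrix.mulVec_mulVec, deltaS, Matrix.sub_mulVec,
    Matrix.smul_mulVec, Matrix.smul_mulVec, Matrix.one_mulVec, smul_sub, coeff221_eq_alpha S k, smul_smul, smul_smul, smul_smul]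
  congr 1
  congr 1
  field_simp

/-- **The one-step projection `P(0) = Q^*(0)Q(0)` at level `j` IS `Setup`'s `Q^*Q` on `T^{(j)}`** (`j + 1 ≤ k`, every coupling).
[cite: Balaban1982Higgs1, (2.30) p.611] -/
theorem cmpL_blockProjA {j : ℕ} (hj1 : j + 1 ≤ k) (g : ScalarField P j N) (i : Fin N) :
    cmpL S hk (Nat.le_of_succ_le hj1) i (blockProjA C (0 : HiggsLattice.VecField P 0) j g)
      = (Qs (setupAt S k) j * B1RG242Torus.Q (setupAt S k) j) *ᵥ cmpL S hk (Nat.le_of_succ_le hj1) i g := by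
  rw [blockProjA, LinearMap.comp_apply, cmpL_avgQAdjLin S hk hj1, cmpL_avgQLin S hk hj1, Matrix.mulVec_mulVec]

/-- **The operator of (2.30) at zero field IS `ℓ^{−2}·(β_jQ^*Q + Δ_j)` of the level-`k` torus tower** (`1 ≤ j`, `j + 1 ≤ k`).
[cite: Balaban1982Higgs1, (2.30) p.611] -/
theorem cmpL_precOpA (ha : 0 < a) (hmsq : 0 ≤ msq) {j : ℕ} (hj1 : 1 ≤ j) (hjk : j + 1 ≤ k) (g : ScalarField P j N)
    (i : Fin N) :
    cmpL S hk (Nat.le_of_succ_le hjk) i (precOpA C Finset.univ (0 : HiggsLattice.VecField P 0) msq a j g)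
      = (P.mesh k ^ 2)⁻¹ •
          ((β (setupAt S k) a j • (Qs (setupAt S k) j * B1RG242Torus.Q (setupAt S k) j) + deltaS S k a msq j)
            *ᵥ cmpL S hk (Nat.le_of_succ_le hjk) i g) := by
  rw [precOpA, LinearMap.add_apply, LinearMap.smul_apply, map_add, map_smul, cmpL_blockProjA S hk C hjk,
    cmpL_deltaKA S hk C ha hmsq hj1 (Nat.le_of_succ_le hjk), beta_coeff_eq S k, Matrix.add_mulVec, Matrix.smul_mulVec,
    smul_add, smul_smul]

/-- **`C^{(j),L^jε}(T_ε,0)` (2.30) AT ZERO FIELD IS `ℓ²·C^{(j)}` OF THE LEVEL-`k` TORUS TOWER** (`1 ≤ j`, `j + 1 ≤ k ≤ K`, every coupling,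
`a > 0`, `m² ≥ 0`): `cmp_{j,i}(C^{(j)}g) = ℓ²·(C_j cmp_{j,i}g)`, `C_j = (β_jQ^*Q + Δ_j)^{−1}` — both inverses are genuine ("It is so",
p. 611: `B1Eq243HiggsModel.isUnit_precOpA_of_next` for the model, `B1RG242Torus.C_arg` for the torus tower).
[cite: Balaban1982Higgs1, (2.30) p.611] -/
theorem cmpL_fluctCovA (ha : 0 < a) (hmsq : 0 ≤ msq) {j : ℕ} (hj1 : 1 ≤ j) (hjk : j + 1 ≤ k) (g : ScalarField P j N)
    (i : Fin N) :
    cmpL S hk (Nat.le_of_succ_le hjk) i (fluctCovA C Finset.univ (0 : HiggsLattice.VecField P 0) msq a j g)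
      = (P.mesh k ^ 2) • (covS S k a msq j *ᵥ cmpL S hk (Nat.le_of_succ_le hjk) i g) := by
  have hℓ2 : P.mesh k ^ 2 ≠ 0 := pow_ne_zero 2 (P.mesh_pos k).ne'
  have hL1 : (1 : ℝ) < P.L := by exact_mod_cast S.hL.2
  have hunit : IsUnit (precOpA C Finset.univ (0 : HiggsLattice.VecField P 0) msq a j : Module.End ℝ (ScalarField P j N)) :=
    B1Eq243HiggsModel.isUnit_precOpA_of_next C Finset.univ (0 : HiggsLattice.VecField P 0) hmsq ha hL1 hj1
      (B1Eq243HiggsModel.isUnit_covOpK_univ_of_pos C (0 : HiggsLattice.VecField P 0) hmsq ha hL1 (by omega))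
  have h1 : precOpA C Finset.univ (0 : HiggsLattice.VecField P 0) msq a j
      (fluctCovA C Finset.univ (0 : HiggsLattice.VecField P 0) msq a j g) = g := by
    have := Ring.mul_inverse_cancel _ hunit
    exact congrArg (fun f : Module.End ℝ (ScalarField P j N) => f g) this
  have h2 := congrArg (fun v => covS S k a msq j *ᵥ v)
    (cmpL_precOpA S hk C ha hmsq hj1 hjk (fluctCovA C Finset.univ (0 : HiggsLattice.VecField P 0) msq a j g) i)
  beta_reduce at h2
  rw [h1, Matrix.mulVec_smul, Matrix.mulVec_mulVec, covS_mul S k a msq ha hmsq hj1, Matrix.one_mulVec] at h2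
  rw [h2, smul_smul, mul_inv_cancel₀ hℓ2, one_smul]

/-- **THE `j`-TH TERM OF (I.2.43) AT ZERO FIELD IS `ℓ²·term_j` OF THE LEVEL-`k` TORUS TOWER** (`1 ≤ j < k ≤ K`, every coupling,
`a > 0`, `m² ≥ 0`): `cmp_i(a_j²(L^jε)^{−4}G^ε_jQ^*_jC^{(j)}Q_jG^ε_j φ) = ℓ²·(α_j²G_jQ^*_jC^{(j)}Q_jG_j cmp_iφ)` — the six powers of
`ℓ` from `G^ε_j, C^{(j)}, G^ε_j` against `a_j²(L^jε)^{−4} = ℓ^{−4}α_j²`. [cite: Balaban1982Higgs1, (2.43) p.612] -/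
theorem cmpAt_termA (ha : 0 < a) (hmsq : 0 ≤ msq) {j : ℕ} (hj1 : 1 ≤ j) (hjk : j < k) (φ : ScalarField P 0 N) (i : Fin N) :
    cmpAt S hk i (termA C (0 : HiggsLattice.VecField P 0) msq a j φ)
      = (P.mesh k ^ 2) • ((tower (setupAt S k) a (msq * P.mesh k ^ 2)).term j *ᵥ cmpAt S hk i φ) := by
  have hℓ : P.mesh k ≠ 0 := (P.mesh_pos k).ne'
  have hjk' : j + 1 ≤ k := hjk
  have hj : j ≤ k := hjk.le
  rw [termA, LinearMap.smul_apply, map_smul, sandwich]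
  simp only [LinearMap.comp_apply]
  rw [cmpAt_propagatorK_level S hk C ha hmsq hj1 hj, cmpAt_avgQkAdj S hk hj, cmpL_fluctCovA S hk C ha hmsq hj1 hjk',
    cmpL_avgQkLin S hk hj, cmpAt_propagatorK_level S hk C ha hmsq hj1 hj, towerTerm_eq, coeff221_eq_alpha S k]
  simp only [Matrix.mulVec_smul, Matrix.mulVec_mulVec, Matrix.smul_mulVec, smul_smul, Matrix.mul_assoc]
  congr 1
  field_simp

end Operators

/-! ## §3 The pieces of (2.6): `G^η_{(j)}(T_η, 0)` of the covariant carrier IS `ℓ²·G^η_{(j)}` of the scalar carrier, colour by colour -/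

section Pieces

variable (S : Shape P) {k : ℕ} (hk : k ≤ P.K) (C : ChargeData N) {msq a : ℝ}

/-- **THE PIECES (2.6) AT ZERO FIELD, COMPONENTWISE**: for every `j`, `cmp_i(G^η_{(j)}(T_ε, 0)φ) = ℓ²·(G^η_{(j)} cmp_iφ)` where on
the left `G^η_{(j)}` is r14's covariant piece `pieceA C 0 m² a k j` ((I.2.43) terms at `A = 0`, every coupling) and on the right p03's
scalar piece `pieceT (setupAt S k) a (m²ℓ²) k j` of the level-`k` torus tower ([B4] (2.34) terms), `ℓ = L^kε`, `1 ≤ k ≤ K`, `a > 0`,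
`m² ≥ 0`. [cite: Balaban1983Higgs3, (2.6) p.424] -/
theorem cmpAt_pieceA (hk1 : 1 ≤ k) (ha : 0 < a) (hmsq : 0 ≤ msq) (j : ℕ) (φ : ScalarField P 0 N) (i : Fin N) :
    cmpAt S hk i (pieceA C (0 : HiggsLattice.VecField P 0) msq a k j φ)
      = (P.mesh k ^ 2) • (pieceT (setupAt S k) a (msq * P.mesh k ^ 2) k j *ᵥ cmpAt S hk i φ) := by
  rcases Nat.eq_zero_or_pos j with rfl | hj1
  · rw [B3Ineq210RegularTorus.pieceA_zero, B3Ineq210ZeroTorus.pieceT_zero]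
    exact cmpAt_propagatorK_level S hk C ha hmsq le_rfl hk1 φ i
  · by_cases hjk : j < k
    · rw [B3Ineq210RegularTorus.pieceA_of_pos hj1 hjk, B3Ineq210ZeroTorus.pieceT_of_pos hj1 hjk]
      exact cmpAt_termA S hk C ha hmsq hj1 hjk φ i
    · rw [B3Ineq210RegularTorus.pieceA_of_le hj1 (not_lt.mp hjk), B3Ineq210ZeroTorus.pieceT_of_le hj1 (not_lt.mp hjk),
        LinearMap.zero_apply, map_zero, Matrix.zero_mulVec, smul_zero]

/-- **THE PIECES (2.6) AT ZERO FIELD ACT AS `ℓ²·G^η_{(j)} ⊗ 1_{ℝ^N}`**: `(G^η_{(j)}(T_ε,0)φ)(x) = Σ_z ℓ²·G^η_{(j)}(e x, e z)·φ(z)` with the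
scalar kernel of the level-`k` torus tower (`e = eSiteAt`, the carrier identification (I.1.2)). [cite: Balaban1983Higgs3, (2.6) p.424] -/
theorem pieceA_zeroField_apply (hk1 : 1 ≤ k) (ha : 0 < a) (hmsq : 0 ≤ msq) (j : ℕ) (φ : ScalarField P 0 N)
    (x : HiggsLattice.Site P 0) :
    pieceA C (0 : HiggsLattice.VecField P 0) msq a k j φ x
      = ∑ z : HiggsLattice.Site P 0, (P.mesh k ^ 2 * pieceT (setupAt S k) a (msq * P.mesh k ^ 2) k j
          (eSiteAt S hk (Nat.zero_le _) x) (eSiteAt S hk (Nat.zero_le _) z)) • φ z := by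
  refine PiLp.ext fun i => ?_
  have h := congrFun (cmpAt_pieceA S hk C hk1 ha hmsq j φ i) (eSiteAt S hk (Nat.zero_le _) x)
  rw [cmpAt_apply_eSiteAt, Pi.smul_apply, smul_eq_mul, Matrix.mulVec, dotProduct] at h
  rw [h, WithLp.ofLp_sum, Finset.sum_apply, Finset.mul_sum]
  refine Fintype.sum_equiv (eSiteAt S hk (Nat.zero_le _)).symm _ _ fun w => ?_
  simp only [cmpAt_apply, Equiv.apply_symm_apply, WithLp.ofLp_smul, Pi.smul_apply, smul_eq_mul, mul_assoc]

/-- On a coordinate basis field `e_{(x′,i′)}` (supported at `x′`): `G^η_{(j)}(T_ε,0)e_{(x′,i′)}(x) = ℓ²G^η_{(j)}(e x, e x′)·e_{(x′,i′)}(x′)`.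
[cite: Balaban1983Higgs3, (2.6) p.424] -/
theorem pieceA_zeroField_cb (hk1 : 1 ≤ k) (ha : 0 < a) (hmsq : 0 ≤ msq) (j : ℕ) (q : HiggsLattice.Site P 0 × Ix N)
    (x : HiggsLattice.Site P 0) :
    pieceA C (0 : HiggsLattice.VecField P 0) msq a k j (cb P N 0 q) x
      = (P.mesh k ^ 2 * pieceT (setupAt S k) a (msq * P.mesh k ^ 2) k j
          (eSiteAt S hk (Nat.zero_le _) x) (eSiteAt S hk (Nat.zero_le _) q.1)) • cb P N 0 q q.1 := by
  rw [pieceA_zeroField_apply S hk C hk1 ha hmsq j]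
  exact Finset.sum_eq_single q.1 (fun z _ hz => by rw [B1Ineq234Concrete.cb_apply_of_ne hz, smul_zero])
    (fun h => absurd (Finset.mem_univ _) h)

/-- The value of the coordinate basis field `e_q` at its site is a unit vector (the basis (I.1.5) is orthonormal).
[cite: Balaban1982Higgs1, (1.5) p.604] -/
theorem norm_cb_self (q : HiggsLattice.Site P 0 × Ix N) : ‖cb P N 0 q q.1‖ = 1 := by
  have h := B1Ineq234Concrete.siteInner_cb_self (P := P) (N := N) (k := 0) q
  unfold HiggsLattice.siteInner at h
  rw [Finset.sum_eq_single q.1 (fun x _ hx => by rw [B1Ineq234Concrete.cb_apply_of_ne hx, inner_zero_left, mul_zero])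
    (fun h => absurd (Finset.mem_univ _) h), real_inner_self_eq_norm_sq] at h
  have hm : P.mesh 0 ^ P.d ≠ 0 := pow_ne_zero _ (P.mesh_pos 0).ne'
  have h2 : ‖cb P N 0 q q.1‖ ^ 2 = 1 := mul_left_cancel₀ hm (h.trans (mul_one _).symm)
  exact (pow_eq_one_iff_of_nonneg (norm_nonneg _) two_ne_zero).mp h2

/-- **The colour block of the kernel of `G^η_{(j)}(T_ε, 0)` is scalar**: `‖(G^η_{(j)}e_{(x′,i′)})(x)‖ = ℓ²·|G^η_{(j)}(e x, e x′)|` for every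
source colour `i′`. [cite: Balaban1983Higgs3, (2.10) p.426] -/
theorem norm_pieceA_cb (hk1 : 1 ≤ k) (ha : 0 < a) (hmsq : 0 ≤ msq) (j : ℕ) (x x' : HiggsLattice.Site P 0) (i' : Ix N) :
    ‖pieceA C (0 : HiggsLattice.VecField P 0) msq a k j (cb P N 0 (x', i')) x‖
      = P.mesh k ^ 2 * |pieceT (setupAt S k) a (msq * P.mesh k ^ 2) k j
          (eSiteAt S hk (Nat.zero_le _) x) (eSiteAt S hk (Nat.zero_le _) x')| := by
  rw [pieceA_zeroField_cb S hk C hk1 ha hmsq j, norm_smul, norm_cb_self, mul_one, Real.norm_eq_abs, abs_mul,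
    abs_of_pos (pow_pos (P.mesh_pos k) 2)]

/-- **The column-sum norm over the source colours**: `Σ_{i′}‖(G^η_{(j)}e_{(x′,i′)})(x)‖ = N·ℓ²·|G^η_{(j)}(e x, e x′)|`.
[cite: Balaban1983Higgs3, (2.10) p.426] -/
theorem sum_norm_pieceA_cb (hk1 : 1 ≤ k) (ha : 0 < a) (hmsq : 0 ≤ msq) (j : ℕ) (x x' : HiggsLattice.Site P 0) :
    ∑ i' : Ix N, ‖pieceA C (0 : HiggsLattice.VecField P 0) msq a k j (cb P N 0 (x', i')) x‖
      = N * (P.mesh k ^ 2 * |pieceT (setupAt S k) a (msq * P.mesh k ^ 2) k j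
          (eSiteAt S hk (Nat.zero_le _) x) (eSiteAt S hk (Nat.zero_le _) x')|) := by
  simp_rw [norm_pieceA_cb S hk C hk1 ha hmsq j x x']
  rw [Finset.sum_const, B3Ineq210RegularTorus.card_Ix, nsmul_eq_mul]

/-- kernel: `(∂^s_μ M)(z, z′) = s^{−1}(M(z + e_μ, z′) − M(z, z′))` for the left difference in the row variable. [folklore] -/
private theorem deriv_mul_apply (Q : Params) (s : ℝ) (μ : Fin Q.d) (M : Matrix (Site Q 0) (Site Q 0) ℝ) (z z' : Site Q 0) :
    (B1RG242Torus.deriv Q 0 s μ * M) z z' = s⁻¹ * (M (z.shift μ) z' - M z z') := by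
  rw [show (B1RG242Torus.deriv Q 0 s μ * M) z z' = (B1RG242Torus.deriv Q 0 s μ *ᵥ fun w => M w z') z from by
      rw [Matrix.mul_apply']; rfl,
    B1RG242Torus.deriv_mulVec]

/-- **The covariant derivative (I.1.7) of a piece at zero field, on a basis field**: `(D^ε_{0,μ}G^η_{(j)}e_{(x′,i′)})(x) =
ε^{−1}ℓ²(G^η_{(j)}(e x + e_μ, e x′) − G^η_{(j)}(e x, e x′))·e_{(x′,i′)}(x′)` (`U(0) = 1`: the plain difference (I.1.4)).
[cite: Balaban1982Higgs1, (1.7) p.605] -/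
theorem covDeriv_pieceA_cb (hk1 : 1 ≤ k) (ha : 0 < a) (hmsq : 0 ≤ msq) (j : ℕ) (q : HiggsLattice.Site P 0 × Ix N)
    (x : HiggsLattice.Site P 0) (μ : Fin P.d) :
    covDeriv C (0 : HiggsLattice.VecField P 0) (pieceA C (0 : HiggsLattice.VecField P 0) msq a k j (cb P N 0 q)) ⟨x, μ⟩
      = ((P.mesh 0)⁻¹ * (P.mesh k ^ 2 *
          (pieceT (setupAt S k) a (msq * P.mesh k ^ 2) k j ((eSiteAt S hk (Nat.zero_le _) x).shift μ)
              (eSiteAt S hk (Nat.zero_le _) q.1)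
            - pieceT (setupAt S k) a (msq * P.mesh k ^ 2) k j (eSiteAt S hk (Nat.zero_le _) x)
              (eSiteAt S hk (Nat.zero_le _) q.1)))) • cb P N 0 q q.1 := by
  rw [HiggsLattice.covDeriv_zero]
  unfold HiggsLattice.sderiv
  rw [show (⟨x, μ⟩ : HiggsLattice.PBond P 0).tgt = x.shift μ from rfl, pieceA_zeroField_cb S hk C hk1 ha hmsq j,
    pieceA_zeroField_cb S hk C hk1 ha hmsq j, eSiteAt_shift, ← sub_smul, smul_smul, ← mul_sub]

/-- `Σ_{i′}‖(D^ε_{0,μ}G^η_{(j)}e_{(x′,i′)})(x)‖ = N·ε^{−1}ℓ²·|G^η_{(j)}(e x + e_μ, e x′) − G^η_{(j)}(e x, e x′)|`.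
[cite: Balaban1983Higgs3, (2.10) p.426] -/
theorem sum_norm_covDeriv_pieceA_cb (hk1 : 1 ≤ k) (ha : 0 < a) (hmsq : 0 ≤ msq) (j : ℕ) (x x' : HiggsLattice.Site P 0)
    (μ : Fin P.d) :
    ∑ i' : Ix N, ‖covDeriv C (0 : HiggsLattice.VecField P 0)
        (pieceA C (0 : HiggsLattice.VecField P 0) msq a k j (cb P N 0 (x', i'))) ⟨x, μ⟩‖
      = N * ((P.mesh 0)⁻¹ * (P.mesh k ^ 2 *
          |pieceT (setupAt S k) a (msq * P.mesh k ^ 2) k j ((eSiteAt S hk (Nat.zero_le _) x).shift μ)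
              (eSiteAt S hk (Nat.zero_le _) x')
            - pieceT (setupAt S k) a (msq * P.mesh k ^ 2) k j (eSiteAt S hk (Nat.zero_le _) x)
              (eSiteAt S hk (Nat.zero_le _) x')|)) := by
  have h0 : 0 < (P.mesh 0)⁻¹ := inv_pos.mpr (P.mesh_pos 0)
  have hterm : ∀ i' : Ix N, ‖covDeriv C (0 : HiggsLattice.VecField P 0)
        (pieceA C (0 : HiggsLattice.VecField P 0) msq a k j (cb P N 0 (x', i'))) ⟨x, μ⟩‖
      = (P.mesh 0)⁻¹ * (P.mesh k ^ 2 *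
          |pieceT (setupAt S k) a (msq * P.mesh k ^ 2) k j ((eSiteAt S hk (Nat.zero_le _) x).shift μ)
              (eSiteAt S hk (Nat.zero_le _) x')
            - pieceT (setupAt S k) a (msq * P.mesh k ^ 2) k j (eSiteAt S hk (Nat.zero_le _) x)
              (eSiteAt S hk (Nat.zero_le _) x')|) := fun i' => by
    rw [covDeriv_pieceA_cb S hk C hk1 ha hmsq j (x', i') x μ, norm_smul, norm_cb_self, mul_one, Real.norm_eq_abs, abs_mul,
      abs_of_pos h0, abs_mul, abs_of_pos (pow_pos (P.mesh_pos k) 2)]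
  rw [Finset.sum_congr rfl fun i' _ => hterm i', Finset.sum_const, B3Ineq210RegularTorus.card_Ix, nsmul_eq_mul]

end Pieces

/-! ## §4 The two carriers of B3 (2.10) at zero background: field-by-field dictionary and the transfer of `Ineq210` -/

section Carriers

variable (S : Shape P) {k : ℕ} (C : ChargeData N) {msq a : ℝ}

/-- **dimension**: the scalar carrier of the level-`k` torus has `d` = the model's `d` (as has r14's carrier,
`B3Ineq210RegularTorus.regTorusKernels_d`). [cite: Balaban1983Higgs3, (2.10) p.426] -/
theorem zero_d (μ : ℝ) : (zeroTorusKernels (setupAt S k) a μ k).d = P.d := rfl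

/-- **length scale**: `L^jη` of the covariant carrier (`η = ε`) is `ℓ·L^jη` of the scalar carrier (`η = L^{−k}`), `ℓ = L^kε`.
[cite: Balaban1983Higgs3, (2.10) p.426] -/
theorem scale_bridge (j : ℕ) :
    (regTorusKernels S C (0 : HiggsLattice.VecField P 0) msq a k).scale j
      = P.mesh k * (zeroTorusKernels (setupAt S k) a (msq * P.mesh k ^ 2) k).scale j := by
  rw [B3Ineq210RegularTorus.scale_eq, B3Ineq210ZeroTorus.scaleT_eq, mesh_eq_mul_spacing S k j]

/-- **distance**: `ε|x − x′|` = `ℓ·η|e x − e x′|_T` — the model's torus distance (I.1.3) IS the sup torus distance of the `Setup`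
lineage under the identification (p14's `T_eSiteAt`). [cite: Balaban1982Higgs1, (1.3) p.604] -/
theorem dist_bridge (hk : k ≤ P.K) (x x' : HiggsLattice.Site P 0) :
    (regTorusKernels S C (0 : HiggsLattice.VecField P 0) msq a k).dist x x'
      = P.mesh k * (zeroTorusKernels (setupAt S k) a (msq * P.mesh k ^ 2) k).dist
          (eSiteAt S hk (Nat.zero_le _) x) (eSiteAt S hk (Nat.zero_le _) x') := by
  rw [B3Ineq210RegularTorus.regTorusKernels_dist]
  show P.mesh 0 * (HiggsLattice.Site.tdist x x' : ℝ) = P.mesh k * ((setupAt S k).eps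
    * B5Ineq137Torus.T (setupAt S k) 0 (eSiteAt S hk (Nat.zero_le _) x) (eSiteAt S hk (Nat.zero_le _) x'))
  rw [T_eSiteAt S hk, mesh_zero_eq_at S k, mul_assoc]

/-- **THE KERNEL FIELD**: `|G^η_{(j)}(T_η, 0; x, x′)|` of the covariant carrier (column-sum norm of the `N × N` colour block, w.r.t. the
`ε^d`-weighted product (I.1.5)) is `N·ℓ^{2−d}` times `|G^η_{(j)}(e x, e x′)|` of the scalar carrier (w.r.t. the `η^d`-weighted product),
`1 ≤ k ≤ K`, `a > 0`, `m² ≥ 0`, every coupling. [cite: Balaban1983Higgs3, (2.10) p.426] -/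
theorem absG_bridge (hk : k ≤ P.K) (hk1 : 1 ≤ k) (ha : 0 < a) (hmsq : 0 ≤ msq) (j : ℕ) (x x' : HiggsLattice.Site P 0) :
    (regTorusKernels S C (0 : HiggsLattice.VecField P 0) msq a k).absG j x x'
      = N * (P.mesh k ^ 2 * (P.mesh k ^ P.d)⁻¹) *
        (zeroTorusKernels (setupAt S k) a (msq * P.mesh k ^ 2) k).absG j
          (eSiteAt S hk (Nat.zero_le _) x) (eSiteAt S hk (Nat.zero_le _) x') := by
  have hℓ : P.mesh k ≠ 0 := (P.mesh_pos k).ne'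
  have hη : (setupAt S k).eps ≠ 0 := (setupAt S k).eps_pos.ne'
  rw [B3Ineq210RegularTorus.regTorusKernels_absG, sum_norm_pieceA_cb S hk C hk1 ha hmsq j x x', mesh_zero_eq_at S k]
  show _ = (N : ℝ) * (P.mesh k ^ 2 * (P.mesh k ^ P.d)⁻¹) * (((setupAt S k).eps ^ P.d)⁻¹ * |pieceT (setupAt S k) a
    (msq * P.mesh k ^ 2) k j (eSiteAt S hk (Nat.zero_le _) x) (eSiteAt S hk (Nat.zero_le _) x')|)
  rw [mul_pow, mul_inv]
  ring

/-- **THE DERIVATIVE FIELD**: `|(D^η_{0,μ}G^η_{(j)})(T_η, 0; x, x′)|` of the covariant carrier (covariant derivative (I.1.7) at `A = 0`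
in the row variable) is `N·ℓ^{1−d}` times `|(∂^η_μG^η_{(j)})(e x, e x′)|` of the scalar carrier (left difference (I.1.4)).
[cite: Balaban1983Higgs3, (2.10) p.426] -/
theorem absDG_bridge (hk : k ≤ P.K) (hk1 : 1 ≤ k) (ha : 0 < a) (hmsq : 0 ≤ msq) (j : ℕ) (μ : Fin P.d) (x x' : HiggsLattice.Site P 0) :
    (regTorusKernels S C (0 : HiggsLattice.VecField P 0) msq a k).absDG j μ x x'
      = N * (P.mesh k * (P.mesh k ^ P.d)⁻¹) *
        (zeroTorusKernels (setupAt S k) a (msq * P.mesh k ^ 2) k).absDG j μ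
          (eSiteAt S hk (Nat.zero_le _) x) (eSiteAt S hk (Nat.zero_le _) x') := by
  have hℓ : P.mesh k ≠ 0 := (P.mesh_pos k).ne'
  have hη : 0 < (setupAt S k).eps := (setupAt S k).eps_pos
  rw [B3Ineq210RegularTorus.regTorusKernels_absDG, sum_norm_covDeriv_pieceA_cb S hk C hk1 ha hmsq j x x' μ,
    mesh_zero_eq_at S k]
  show _ = (N : ℝ) * (P.mesh k * (P.mesh k ^ P.d)⁻¹) * (((setupAt S k).eps ^ P.d)⁻¹ *
    |(B1RG242Torus.deriv (setupAt S k) 0 (setupAt S k).eps μ * pieceT (setupAt S k) a (msq * P.mesh k ^ 2) k j)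
      (eSiteAt S hk (Nat.zero_le _) x) (eSiteAt S hk (Nat.zero_le _) x')|)
  rw [deriv_mul_apply, abs_mul, abs_of_pos (inv_pos.mpr hη), mul_pow, mul_inv, mul_inv]
  field_simp

/-- kernel: `s^{2−d} = s²·(s^d)^{−1}` for `s > 0` (real exponent). [folklore] -/
private theorem rpow_two_sub_nat {s : ℝ} (hs : 0 < s) (d : ℕ) : s ^ ((2 : ℝ) - (d : ℝ)) = s ^ 2 * (s ^ d)⁻¹ := by
  rw [Real.rpow_sub hs, div_eq_mul_inv, Real.rpow_natCast, Real.rpow_two]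

/-- kernel: `s^{1−d} = s·(s^d)^{−1}` for `s > 0` (real exponent). [folklore] -/
private theorem rpow_one_sub_nat {s : ℝ} (hs : 0 < s) (d : ℕ) : s ^ ((1 : ℝ) - (d : ℝ)) = s * (s ^ d)⁻¹ := by
  rw [Real.rpow_sub hs, div_eq_mul_inv, Real.rpow_natCast, Real.rpow_one]

/-- **TRANSFER, scalar ⇒ covariant**: if p03's scalar carrier of the level-`k` torus tower at mass `m²ℓ²` satisfies (2.10) with
constants `(δ₁, C)`, then r14's covariant carrier at `A = 0` (every coupling `U = exp(qεeA)`, every `N`) satisfies (2.10) with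
`(δ₁, N·C)` — the powers of `ℓ = L^kε` cancel exactly between kernel, length scale and distance. `1 ≤ k ≤ K`, `a > 0`, `m² ≥ 0`.
[cite: Balaban1983Higgs3, (2.10) p.426] -/
theorem ineq210_reg_of_zero (hk : k ≤ P.K) (hk1 : 1 ≤ k) (ha : 0 < a) (hmsq : 0 ≤ msq) {δ₁ Cst : ℝ}
    (h : (zeroTorusKernels (setupAt S k) a (msq * P.mesh k ^ 2) k).Ineq210 δ₁ Cst) :
    (regTorusKernels S C (0 : HiggsLattice.VecField P 0) msq a k).Ineq210 δ₁ (N * Cst) := by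
  have hℓ : 0 < P.mesh k := P.mesh_pos k
  intro j x x'
  obtain ⟨hv, hd⟩ := h j (eSiteAt S hk (Nat.zero_le _) x) (eSiteAt S hk (Nat.zero_le _) x')
  have hs : 0 < (zeroTorusKernels (setupAt S k) a (msq * P.mesh k ^ 2) k).scale j := by
    rw [B3Ineq210ZeroTorus.scaleT_eq]; exact (setupAt S k).spacing_pos j
  have hexp : ∀ D : ℝ,
      Real.exp (-(δ₁ * (P.mesh k * (zeroTorusKernels (setupAt S k) a (msq * P.mesh k ^ 2) k).scale j)⁻¹ * (P.mesh k * D)))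
        = Real.exp (-(δ₁ * ((zeroTorusKernels (setupAt S k) a (msq * P.mesh k ^ 2) k).scale j)⁻¹ * D)) := fun D => by
    congr 2
    field_simp
  rw [zero_d] at hv hd
  rw [B3Ineq210RegularTorus.regTorusKernels_d, scale_bridge S C, dist_bridge S C hk, absG_bridge S C hk hk1 ha hmsq, hexp,
    Real.mul_rpow hℓ.le hs.le, rpow_two_sub_nat hℓ]
  refine ⟨?_, fun μ => ?_⟩
  · refine le_of_le_of_eq (mul_le_mul_of_nonneg_left hv (by positivity)) ?_
    ring
  · rw [absDG_bridge S C hk hk1 ha hmsq, Real.mul_rpow hℓ.le hs.le, rpow_one_sub_nat hℓ]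
    refine le_of_le_of_eq (mul_le_mul_of_nonneg_left (hd μ) (by positivity)) ?_
    ring

/-- **TRANSFER, covariant ⇒ scalar** (`N ≥ 1`): conversely (2.10) for r14's carrier at `A = 0` with `(δ₁, C)` gives (2.10) for p03's
scalar carrier of the level-`k` torus tower at mass `m²ℓ²` with `(δ₁, C/N)` — the two (2.10) statements at zero background are ONE.
[cite: Balaban1983Higgs3, (2.10) p.426] -/
theorem ineq210_zero_of_reg (hk : k ≤ P.K) (hk1 : 1 ≤ k) (ha : 0 < a) (hmsq : 0 ≤ msq) (hN : 1 ≤ N) {δ₁ Cst : ℝ}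
    (h : (regTorusKernels S C (0 : HiggsLattice.VecField P 0) msq a k).Ineq210 δ₁ Cst) :
    (zeroTorusKernels (setupAt S k) a (msq * P.mesh k ^ 2) k).Ineq210 δ₁ (Cst / N) := by
  have hℓ : 0 < P.mesh k := P.mesh_pos k
  have hNpos : (0 : ℝ) < N := by exact_mod_cast hN
  have hN0 : (N : ℝ) ≠ 0 := hNpos.ne'
  intro j z z'
  obtain ⟨x, rfl⟩ : ∃ x, z = eSiteAt S hk (Nat.zero_le _) x := ⟨(eSiteAt S hk (Nat.zero_le _)).symm z, by simp⟩
  obtain ⟨x', rfl⟩ : ∃ x', z' = eSiteAt S hk (Nat.zero_le _) x' := ⟨(eSiteAt S hk (Nat.zero_le _)).symm z', by simp⟩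
  obtain ⟨hv, hd⟩ := h j x x'
  have hs : 0 < (zeroTorusKernels (setupAt S k) a (msq * P.mesh k ^ 2) k).scale j := by
    rw [B3Ineq210ZeroTorus.scaleT_eq]; exact (setupAt S k).spacing_pos j
  have hexp : ∀ D : ℝ,
      Real.exp (-(δ₁ * (P.mesh k * (zeroTorusKernels (setupAt S k) a (msq * P.mesh k ^ 2) k).scale j)⁻¹ * (P.mesh k * D)))
        = Real.exp (-(δ₁ * ((zeroTorusKernels (setupAt S k) a (msq * P.mesh k ^ 2) k).scale j)⁻¹ * D)) := fun D => by
    congr 2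
    field_simp
  rw [zero_d]
  rw [B3Ineq210RegularTorus.regTorusKernels_d, scale_bridge S C, dist_bridge S C hk, absG_bridge S C hk hk1 ha hmsq, hexp,
    Real.mul_rpow hℓ.le hs.le, rpow_two_sub_nat hℓ] at hv
  have hfac2 : 0 < (N : ℝ) * (P.mesh k ^ 2 * (P.mesh k ^ P.d)⁻¹) := by positivity
  have hfac1 : 0 < (N : ℝ) * (P.mesh k * (P.mesh k ^ P.d)⁻¹) := by positivity
  refine ⟨?_, fun μ => ?_⟩
  · refine le_of_mul_le_mul_left (hv.trans (le_of_eq ?_)) hfac2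
    field_simp
  · have hdμ := hd μ
    rw [B3Ineq210RegularTorus.regTorusKernels_d, scale_bridge S C, dist_bridge S C hk, absDG_bridge S C hk hk1 ha hmsq, hexp,
      Real.mul_rpow hℓ.le hs.le, rpow_one_sub_nat hℓ] at hdμ
    refine le_of_mul_le_mul_left (hdμ.trans (le_of_eq ?_)) hfac1
    field_simp

end Carriers

/-! ## §5 (2.10) at `A = 0` for the covariant carrier, HYPOTHESIS-FREE, from p03's torus theorem through the bridge

p03's `B3Ineq210ZeroTorus.ineq210_zeroTorus` fixes the mass `m²` of the scalar tower; through the bridge the mass is `m²ℓ²`,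
`ℓ = L^kε ≤ 1` varying with the volume and the scale, so its assembly is repeated here verbatim over a MASS WINDOW `0 ≤ m² ≤ m₊²`
(the kernel inputs `B4Thm110ZeroTorus.kerBounds_torus` and p14's `B1Ineq225ZeroFieldTorus.G0unit_decay_cap` are already uniform
in such a window). -/

section MassWindow

open B4Thm110ZeroTorus (kerBounds_torus)
open B5Leaf237C0Torus (gamma0 dK0 gamma0_pos dK0_pos)
open B5Display136Torus (G0unit)
open B5Ineq137Torus (T)
open B1Ineq225ZeroFieldTorus (G0unit_decay_cap)
open B4Ineq116Torus (spacing_le_spacing)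
open B3Ineq210ZeroTorus (abs_pieceT_le_of abs_derivPieceT_le_of)

/-- **B3 (2.10) for p03's TORUS MODEL INSTANCE `A = B̃ = 0`, `Ω = T_η`, uniformly in the volume, the scale AND THE MASS
`0 ≤ m² ≤ m₊²`**: `∃ δ₁ C > 0` (functions of `d, L, a, m₊²`) with `(zeroTorusKernels Q a m² k).Ineq210 δ₁ C` for every volume `Q`
with these `d, L`, every `1 ≤ k ≤ K` and every `m² ∈ [0, m₊²]` — p03's `ineq210_zeroTorus` (one mass) re-assembled over the window
from the same located inputs (`kerBounds_torus`, `G0unit_decay_cap`, `abs_pieceT_le_of`, `abs_derivPieceT_le_of`).  Print: *"For the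
propagators G^η_{(j)} we apply the inequality |G^η_{(j)}(Ω, B̃; x, x′)| ≤ O(1)(L^jη)^{−d+2}e^{−δ₁(L^jη)^{−1}|x−x′|}, (2.10) and if the
propagator is differentiated, then for each differentiation, there is an additional factor (L^jη)^{−1} on the right side."*
[cite: Balaban1983Higgs3, (2.10) p.426] -/
theorem ineq210_zeroTorus_massWindow (d L : ℕ) (hd : 1 ≤ d) (hL : Odd L ∧ 1 < L) {a : ℝ} (ha : 0 < a) {m2plus : ℝ}
    (hm2 : 0 ≤ m2plus) :
    ∃ δ₁ C : ℝ, 0 < δ₁ ∧ 0 < C ∧ ∀ (Q : Params), Q.d = d → Q.L = L →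
      ∀ msq : ℝ, 0 ≤ msq → msq ≤ m2plus → ∀ k : ℕ, 1 ≤ k → k ≤ Q.K → (zeroTorusKernels Q a msq k).Ineq210 δ₁ C := by
  obtain ⟨C, δ, hC, hδ, hK⟩ := kerBounds_torus d L hd hL ha m2plus
  -- the `j = 0` constants depend on `d, L, a, m₊²` only; read them off any volume with these `d, L`
  obtain ⟨P₀, hP₀d, hP₀L⟩ : ∃ P₀ : Params, P₀.d = d ∧ P₀.L = L := ⟨⟨d, L, 0, 0, hd, hL⟩, rfl, rfl⟩
  set C₀ := 2 / gamma0 L a with hC₀def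
  set δ₀ := dK0 d L a m2plus with hδ₀def
  have hC₀ : 0 ≤ C₀ := by
    rw [hC₀def, ← hP₀L]; exact (div_pos two_pos (gamma0_pos (P := P₀) ha)).le
  have hδ₀ : 0 < δ₀ := by rw [hδ₀def, ← hP₀d, ← hP₀L]; exact dK0_pos (P := P₀) ha hm2
  refine ⟨min δ₀ (δ / 2),
    (2 * C₀ * Real.exp δ₀ + C₀) + a ^ 2 * (C ^ 3 * B4Sect5Proof.latticeConst d (δ / 2) ^ 2 * Real.exp δ) + 1,
    lt_min hδ₀ (by positivity), by positivity, ?_⟩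
  intro Q hQd hQL msq hmsq hcapm k _ hkK
  have hkm : k ≤ Q.m + Q.K := hkK.trans (Nat.le_add_left _ _)
  have hcap : Q.spacing k ^ 2 * msq ≤ m2plus := by
    have hs1 : Q.spacing k ≤ 1 := by rw [← Q.spacing_K]; exact spacing_le_spacing Q hkK
    have hs0 := (Q.spacing_pos k).le
    calc Q.spacing k ^ 2 * msq ≤ 1 * msq := mul_le_mul_of_nonneg_right (pow_le_one₀ hs0 hs1) hmsq
      _ = msq := one_mul _
      _ ≤ m2plus := hcapm
  have hKB := hK Q hQd hQL msq hmsq k hkm hcap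
  subst hQd hQL
  have hG0 : ∀ x x' : Site Q 0, |G0unit Q a msq x x'| ≤ C₀ * Real.exp (-(δ₀ * T Q 0 x x')) :=
    fun x x' => G0unit_decay_cap (Q := Q) ha hmsq hcapm x x'
  intro j x x'
  have hsw2 : 0 ≤ Q.spacing j ^ 2 * (Q.spacing j ^ Q.d)⁻¹ := by have := Q.spacing_pos j; positivity
  have hsw1 : 0 ≤ Q.spacing j * (Q.spacing j ^ Q.d)⁻¹ := by have := Q.spacing_pos j; positivity
  have hsc : ∀ D : ℝ, (Q.spacing j)⁻¹ * (Q.eps * D) = D / (Q.L : ℝ) ^ j := fun D => by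
    unfold Params.spacing
    rw [mul_inv, mul_assoc, ← mul_assoc (Q.eps)⁻¹, inv_mul_cancel₀ Q.eps_pos.ne', one_mul, div_eq_inv_mul]
  refine ⟨?_, fun μ => ?_⟩
  · show (Q.eps ^ Q.d)⁻¹ * |pieceT Q a msq k j x x'|
      ≤ ((2 * C₀ * Real.exp δ₀ + C₀) + a ^ 2 * (C ^ 3 * B4Sect5Proof.latticeConst Q.d (δ / 2) ^ 2 * Real.exp δ) + 1)
        * Q.spacing j ^ ((2 : ℝ) - (Q.d : ℝ))
        * Real.exp (-(min δ₀ (δ / 2) * (Q.spacing j)⁻¹ * (Q.eps * T Q 0 x x')))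
    rw [rpow_two_sub_nat (Q.spacing_pos j), mul_assoc (min δ₀ (δ / 2)) ((Q.spacing j)⁻¹), hsc]
    refine (abs_pieceT_le_of ha hmsq hkm hC hδ hC₀ hδ₀ hKB hG0 j x x').trans ?_
    refine mul_le_mul_of_nonneg_right (mul_le_mul_of_nonneg_right ?_ hsw2) (Real.exp_pos _).le
    have : 0 ≤ 2 * C₀ * Real.exp δ₀ := by positivity
    linarith
  · show (Q.eps ^ Q.d)⁻¹ * |(B1RG242Torus.deriv Q 0 Q.eps μ * pieceT Q a msq k j) x x'|
      ≤ ((2 * C₀ * Real.exp δ₀ + C₀) + a ^ 2 * (C ^ 3 * B4Sect5Proof.latticeConst Q.d (δ / 2) ^ 2 * Real.exp δ) + 1)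
        * Q.spacing j ^ ((1 : ℝ) - (Q.d : ℝ))
        * Real.exp (-(min δ₀ (δ / 2) * (Q.spacing j)⁻¹ * (Q.eps * T Q 0 x x')))
    rw [rpow_one_sub_nat (Q.spacing_pos j), mul_assoc (min δ₀ (δ / 2)) ((Q.spacing j)⁻¹), hsc]
    refine (abs_derivPieceT_le_of ha hmsq hkm hC hδ hC₀ hδ₀ hKB hG0 j μ x x').trans ?_
    refine mul_le_mul_of_nonneg_right (mul_le_mul_of_nonneg_right ?_ hsw1) (Real.exp_pos _).le
    linarith

end MassWindow

section ZeroFieldMember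

/-- Monotonicity of (2.10) in its constant `O(1)`. [cite: Balaban1983Higgs3, (2.10) p.426] -/
theorem ineq210_mono (K : ScaledKernels) {δ₁ C C' : ℝ} (hCC' : C ≤ C') (h : K.Ineq210 δ₁ C) : K.Ineq210 δ₁ C' := by
  intro j x x'
  obtain ⟨hv, hd⟩ := h j x x'
  have hs : 0 < K.scale j := by
    unfold ScaledKernels.scale
    exact mul_pos (pow_pos (lt_trans one_pos K.one_lt_L) j) K.η_pos
  refine ⟨hv.trans ?_, fun μ => (hd μ).trans ?_⟩
  · exact mul_le_mul_of_nonneg_right (mul_le_mul_of_nonneg_right hCC' (Real.rpow_nonneg hs.le _)) (Real.exp_pos _).le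
  · exact mul_le_mul_of_nonneg_right (mul_le_mul_of_nonneg_right hCC' (Real.rpow_nonneg hs.le _)) (Real.exp_pos _).le

/-- **B3 (2.10) p. 426 FOR r14's COVARIANT TORUS CARRIER AT ZERO BACKGROUND, HYPOTHESIS-FREE** — the `A = 0` member of
`B3Ineq210RegularTorus.ineq210_regularTorus` WITHOUT its cube-tiling, smallness and `m² > 0` hypotheses: for `d ≥ 1`, odd
`L > 1`, `a > 0`, `m² ≥ 0`, every `N` and every coupling `U = exp(qεeA)` there are `δ₁, C > 0` (functions of `d, L, a, m², N`) such that
for EVERY volume of the (Higgs)₂,₃ torus family (`S : Shape P`) with these `d, L` and every scale `1 ≤ k ≤ K` with `L^kε ≤ 1`: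
`(regTorusKernels S C 0 m² a k).Ineq210 δ₁ C`.  Route: p03's torus theorem over the mass window `[0, m²]`
(`ineq210_zeroTorus_massWindow` at the level-`k` torus `setupAt S k`, mass `m²(L^kε)² ≤ m²`) and the transfer `ineq210_reg_of_zero`.
[cite: Balaban1983Higgs3, (2.10) p.426] -/
theorem ineq210_regularTorus_zeroField (d L N : ℕ) (hd : 1 ≤ d) (hL : Odd L ∧ 1 < L) {a : ℝ} (ha : 0 < a) {msq : ℝ}
    (hmsq : 0 ≤ msq) (C : ChargeData N) :
    ∃ δ₁ Cst : ℝ, 0 < δ₁ ∧ 0 < Cst ∧ ∀ (P : HiggsLattice.Params) (S : Shape P), P.d = d → P.L = L →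
      ∀ {k : ℕ}, 1 ≤ k → k ≤ P.K → P.mesh k ≤ 1 →
        (regTorusKernels S C (0 : HiggsLattice.VecField P 0) msq a k).Ineq210 δ₁ Cst := by
  obtain ⟨δ₁, C₀, hδ₁, hC₀, h⟩ := ineq210_zeroTorus_massWindow d L hd hL ha hmsq
  refine ⟨δ₁, (N + 1) * C₀, hδ₁, by positivity, ?_⟩
  intro P S hPd hPL k hk1 hkK hmesh
  have hm' : 0 ≤ msq * P.mesh k ^ 2 := mul_nonneg hmsq (sq_nonneg _)
  have hcap : msq * P.mesh k ^ 2 ≤ msq := by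
    have h1 : P.mesh k ^ 2 ≤ 1 := pow_le_one₀ (P.mesh_pos k).le hmesh
    calc msq * P.mesh k ^ 2 ≤ msq * 1 := mul_le_mul_of_nonneg_left h1 hmsq
      _ = msq := mul_one _
  have hZ := h (setupAt S k) hPd hPL (msq * P.mesh k ^ 2) hm' hcap k hk1 le_rfl
  refine ineq210_mono _ ?_ (ineq210_reg_of_zero S C hkK hk1 ha hmsq hZ)
  nlinarith

/-- **Non-vacuity of the hypotheses** of `ineq210_regularTorus_zeroField`: volumes of the family with `1 ≤ K` and `L^1ε ≤ 1` exist for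
every `d ≥ 1`, odd `L > 1` (r14's witness `B3Ineq210RegularTorus.regularTorus_hypotheses_nonvacuous`: `ε = 1/L`, `K = 1`).
[cite: Balaban1982Higgs1, (1.2) p.604] -/
theorem zeroField_hypotheses_nonvacuous (d L : ℕ) (hd : 1 ≤ d) (hL : Odd L ∧ 1 < L) :
    ∃ (P : HiggsLattice.Params) (_S : Shape P), P.d = d ∧ P.L = L ∧ 1 ≤ P.K ∧ P.mesh 1 ≤ 1 := by
  obtain ⟨_, _, P, S, hPd, hPL, _, _, hK, hmesh⟩ := B3Ineq210RegularTorus.regularTorus_hypotheses_nonvacuous d L hd hL 0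
  exact ⟨P, S, hPd, hPL, hK, hmesh⟩

end ZeroFieldMember

end Literature.MathematicalPhysics.QuantumFieldTheory.Balaban1983to89.B3Ineq210RegularZeroBridge

end
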